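import Summits.BirchSwinnertonDyer.BirchSwinnertonDyer.Theorems.GenusKolyvaginAtTwoPowDvdShaCardAtTwoRTLocalEigenDualityAtKolyvaginPlace
import Summits.BirchSwinnertonDyer.BirchSwinnertonDyer.Theorems.GenusKolyvaginAtTwoShaCardDvdPowAtTwoRTNormSharpPairing
import Summits.BirchSwinnertonDyer.BirchSwinnertonDyer.Theorems.GenusKolyvaginAtTwoShaCardDvdPowAtTwoRTBottomLayerInvisible
import HarnessLib

/-!
# Route `GenusKolyvaginAtTwo`, crux U_T `ShaCardDvdPowAtTwoRT` (stmt-BirchSwinnertonDyer-23298; upper half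
# `#Ш(E/K)[2^∞] ∣ 2^(2M₀)`) — THE NORM-SHARP LAW AND THE INVISIBLE BOTTOM LAYER AT A DEEP INERT KOLYVAGIN PLACE OF THE
# HEEGNER FIELD, ASSEMBLED (no displayed local structure left)

Seat `bsd-line-gk2-p3` g25 (PROVER seat 3/3, cell `bsd-f1-sign2`), `--supports stmt-BirchSwinnertonDyer-23298` (helper; closes nothing).
THEOREMS ONLY (no definition, no named fact, no `sorry`).  BSD is NOT proved by any of this; neither is U_T nor any stub.

WHY (seat memo `Cruxes/ShaCardDvdPowAtTwoRT/Lines/norm-sharp-upper-gk2p3.md` §2–§3).  This lineage's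
`…RTLocalEigenDualityAtKolyvaginPlace.addOrderOf_invWeilPairing_localization_eq_of_same_sign` (g23) is McCallum's Lemma 5.3 at `p = 2`
for two SAME-SIGN `τ`-EIGEN classes: `addOrderOf inv_λ(loc z ∪ₑ loc x) = 2^(α + β − (M+1))`, one bit lost.  Every certificate of the
UPPER half of Kolyvagin's structure theorem (McCallum Thm. 5.4 / 5.8) is such a local pairing between the singular part `loc x` of a
Kolyvagin class (eigen, Gross 5.4) and the unramified localisation `loc z` of a Selmer lift of a generator of `Ш(E/K)` — and THAT class
need not be eigen at 2.  Here the two pure-algebra files `…ShaCardDvdPowAtTwoRTNormSharpPairing` (p740273) and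
`…ShaCardDvdPowAtTwoRTBottomLayerInvisible` (p740653) are instantiated on the route's frame exactly as g23 instantiated the lost-bit law
(`σ_* = conjActPlace` preserves `inv_λ(· ∪ₑ ·)`: `…RTLocalConjInvariance`; the Kummer condition is parametrised `τ̃_*`-equivariantly by
`E[2^M](K̄)`: `…RTUnramifiedParametrization`; `E[2^M](K̄)` is free of rank one over `ℤ/2^M[τ̃_*]` on `Δ < 0`: `…RTRegularFrameAtTwo`):
* §1 **`addOrderOf_invWeilPairing_localization_eq_of_norm`** — `z` ARBITRARY with `loc_λ z` in the Kummer condition, `x` eigen of sign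
  `ε`, «`2^j (loc_λ z + ε σ_* loc_λ z) = 0 ⟺ α ≤ j`» (the local order of the NORM `loc_λ z + ε σ_*loc_λ z = loc_λ(z + ετ_* z)`, `conjActPlace_localization_self`), «`2^j loc_λ x` Kummer `⟺ β ≤ j`» ⟹
  **`addOrderOf inv_λ(loc z ∪ₑ loc x) = 2^(α + β − M)`** — NO lost bit unless the norm of `z` drops order; flipped form; threshold form.
* §2 **`two_pow_smul_localization_norm_eq_zero_of_invWeilPairing_eq_zero`** — SHARP ANNIHILATION: `inv_λ(loc z ∪ₑ loc x) = 0 ⟹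
  2^(M − β) • (loc_λ z + ε σ_* loc_λ z) = 0` (Kolyvagin's duality step for an arbitrary Selmer class: one bit sharper than the eigen frame).
* §3 **`invWeilPairing_localization_eq_zero_of_two_smul_of_conjAct_eq`** — THE INVISIBLE BOTTOM LAYER: `2 • loc_λ z = 0` and `τ_* z = z`
  ⟹ `inv_λ(loc z ∪ₑ loc x) = 0` for EVERY eigen `x` (either sign, any Kummer threshold) — the localisation of a `τ`-invariant `2`-torsion
  Selmer class (one restricted from `ℚ`) is invisible to every Kolyvagin certificate over `K`.

References: [McCallumLMS1991] §4 Prop. 4.7, §5 Lemma 5.3, Thm. 5.4 (16)–(23), Thm. 5.8; [Kolyvagin1991MathAnn] Thm. 2.1; [GrossLMS1991]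
Prop. 5.4, §8 Prop. 8.1–8.2; [Jetchev2008] §3.2 (2), §5 Thm. 5.1; [MilneADT2006] I Cor. 2.3.
-/

set_option autoImplicit false

noncomputable section

open scoped Classical
open Function Field NumberField IsDedekindDomain WeierstrassCurve
open Literature.NumberTheory.EllipticCurves Literature.NumberTheory.GaloisRepresentations
open Literature.NumberTheory.GaloisCohomology
open Literature.NumberTheory.Automorphic
open Summit.BirchSwinnertonDyer.Rank1Residual.X11b.Relaxation
open Summit.BirchSwinnertonDyer.Rank1Residual.JET.GlobalDuality

-- the Theorems namespace of this sub repeats the summit name by design (D-0017 nested layout)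
set_option linter.dupNamespace false

namespace Summit.BirchSwinnertonDyer.BirchSwinnertonDyer.Theorems.GenusExact.PlusDescent

variable (W : WeierstrassCurve ℚ) (K : Type) [Field K] [NumberField K] [W.IsElliptic] [W.IsGloballyMinimal]

section Frame

variable (hK : IsImaginaryQuadratic K) (hΔ : W.Δ < 0)
    {M ℓ : ℕ} (hM : 1 ≤ M)
    (hℓ : Zhang2014.IsKolyvaginPrime (W.conductorNorm ℤ) W K 2 ℓ) (hk : M ≤ Zhang2014.kolyvaginIndex W 2 ℓ)
    (hF : FrobEqFrobInfty W K (2 ^ M) ℓ) (w : HeightOneSpectrum (𝓞 K)) (hw : (ℓ : 𝓞 K) ∈ w.asIdeal)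
    {τ : K ≃ₐ[ℚ] K} (hτ1 : τ ≠ 1) (hττ : τ * τ = 1) (hfix : τ • w = w)
    (e : (W.baseChange K).geomTorsion ((2 ^ M : ℕ) : ℤ) → (W.baseChange K).geomTorsion ((2 ^ M : ℕ) : ℤ) → AlgebraicClosure K)
    (hμ : ∀ S T, e S T ^ (2 ^ M) = 1)
    (hadd₁ : ∀ S₁ S₂ T, e (S₁ + S₂) T = e S₁ T * e S₂ T)
    (hadd₂ : ∀ S T₁ T₂, e S (T₁ + T₂) = e S T₁ * e S T₂)
    (hgal : ∀ (γ : absoluteGaloisGroup K) (S T : (W.baseChange K).geomTorsion ((2 ^ M : ℕ) : ℤ)), γ • e S T = e (γ • S) (γ • T))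
    (halt : ∀ T, e T T = 1) (hnondeg : ∀ T, (∀ S, e S T = 1) → T = 0)
    (hte : ∀ S T, e ((isLiftOfAut_liftAutPlace τ hfix).torsionMap W ((2 ^ M : ℕ) : ℤ) S)
      ((isLiftOfAut_liftAutPlace τ hfix).torsionMap W ((2 ^ M : ℕ) : ℤ) T) = liftAutPlace τ hfix (e S T))
    (inv : LocalInvariants K (2 ^ M)) (hinj : Injective (inv (Sum.inr w))) (hinvc : inv.IsConjCompatible τ)

/-! ## §1 The norm-sharp law, assembled -/

include hK hΔ hM hℓ hk hF hw hτ1 hττ halt hnondeg hte hinj hinvc in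
/-- **THE NORM-SHARP LAW AT A DEEP INERT KOLYVAGIN PLACE (assembled).**  Setting of
`addOrderOf_invWeilPairing_localization_eq_of_same_sign` (`K` imaginary quadratic, `τ ≠ 1`, `τ² = 1`; `E/ℚ` globally minimal, `Δ < 0`;
`ℓ` Zhang–Kolyvagin at `2` with `1 ≤ M ≤ M(ℓ)`, `FrobEqFrobInfty W K (2^M) ℓ`; `λ ∋ ℓ`, `τ • λ = λ`; Weil datum equivariant for the
adapted lift; `inv` injective at `λ` and conj-compatible).  For `x` with `τ_* x = εx` (`ε = ±1`) and «`2^j loc_λ x` Kummer `⟺ β ≤ j`», and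
ANY `z` with `loc_λ z` Kummer and «`2^j • (loc_λ z + ε σ_* loc_λ z) = 0 ⟺ α ≤ j`» (the local order `2^α` of the NORM; `σ_* loc_λ z = loc_λ(τ_* z)` by `conjActPlace_localization_self`):
**`addOrderOf (inv_λ(loc_λ z ∪ₑ loc_λ x)) = 2^(α + β − M)`**.  For `τ_* z = εz` the norm is `2z` and this is the lost-bit law; for a
`z` whose norm keeps full local order NO bit is lost. [cite: McCallumLMS1991, §5 Lemma 5.3 and proof of Thm. 5.4]
[cite: Kolyvagin1991MathAnn, Thm. 2.1] -/
theorem addOrderOf_invWeilPairing_localization_eq_of_norm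
    {z x : galoisCohomology ((W.baseChange K).torsionGaloisModule ((2 ^ M : ℕ) : ℤ)) 1} {ε : ℤ} (hε : ε = 1 ∨ ε = -1)
    (hx : conjAct W τ ((2 ^ M : ℕ) : ℤ) x = ε • x)
    (hzS : galoisCohomology.localization ((W.baseChange K).torsionGaloisModule ((2 ^ M : ℕ) : ℤ)) (Sum.inr w : Place K) 1 z ∈
      (W.baseChange K).kummerSelmerStructure ((2 ^ M : ℕ) : ℤ) (Sum.inr w))
    {α β : ℕ}
    (hα : ∀ j : ℕ, (2 ^ j) • (galoisCohomology.localization ((W.baseChange K).torsionGaloisModule ((2 ^ M : ℕ) : ℤ))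
      (Sum.inr w : Place K) 1 z + ε • conjActPlace W τ ((2 ^ M : ℕ) : ℤ) hfix (galoisCohomology.localization
      ((W.baseChange K).torsionGaloisModule ((2 ^ M : ℕ) : ℤ)) (Sum.inr w : Place K) 1 z)) = 0 ↔ α ≤ j)
    (hβ : ∀ j : ℕ, (2 ^ j) • galoisCohomology.localization ((W.baseChange K).torsionGaloisModule ((2 ^ M : ℕ) : ℤ))
      (Sum.inr w : Place K) 1 x ∈ (W.baseChange K).kummerSelmerStructure ((2 ^ M : ℕ) : ℤ) (Sum.inr w) ↔ β ≤ j) :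
    addOrderOf (invWeilPairing (W.baseChange K) (2 ^ M) e hμ hadd₁ hadd₂ hgal inv (Sum.inr w)
        (galoisCohomology.localization ((W.baseChange K).torsionGaloisModule ((2 ^ M : ℕ) : ℤ)) (Sum.inr w : Place K) 1 z)
        (galoisCohomology.localization ((W.baseChange K).torsionGaloisModule ((2 ^ M : ℕ) : ℤ)) (Sum.inr w : Place K) 1 x)) =
      2 ^ (α + β - M) := by
  haveI : Fact (Nat.Prime 2) := ⟨Nat.prime_two⟩
  have hM0 : M ≠ 0 := by omega
  set loc := galoisCohomology.localization ((W.baseChange K).torsionGaloisModule ((2 ^ M : ℕ) : ℤ)) (Sum.inr w : Place K) 1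
    with hloc
  set σ := conjActPlace W τ ((2 ^ M : ℕ) : ℤ) hfix with hσdef
  set t := (isLiftOfAut_liftAutPlace τ hfix).torsionMap W ((2 ^ M : ℕ) : ℤ) with htdef
  set b := invWeilPairing (W.baseChange K) (2 ^ M) e hμ hadd₁ hadd₂ hgal inv (Sum.inr w) with hb
  -- good reduction and `2 ∉ λ`
  obtain ⟨hgood, hpw⟩ := hasGoodReductionAt_of_zhangKolyvaginPrime W K hℓ w hw 1
  have hpw' : ((2 : ℕ) : 𝓞 K) ∉ w.asIdeal := by rwa [pow_one, Int.cast_natCast] at hpw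
  -- the `τ`-structure
  have hσ : ∀ X, σ (σ X) = X := fun X ↦ conjActPlace_conjActPlace_self W τ (2 ^ M) hττ hfix X
  have hσb := invWeilPairing_conjActPlace_self W τ (2 ^ M) e hμ hadd₁ hadd₂ hgal hfix hte inv hinvc
  -- the unramified parametrisation and the regular frame
  obtain ⟨unr, hunr0, hunrL, hLunr, hunr⟩ :=
    exists_unramified_parametrization_kummer W K hK hℓ hk w hw hpw' hgood τ hfix
  obtain ⟨Q₀, htor, hspan, hfree, ht⟩ := exists_regular_frame_liftAutPlace W K hK hΔ hM hℓ hk hF w hw hτ1 hfix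
  -- `loc z = unr Q`; the norm class localises to `unr (Q + ε tQ)`
  obtain ⟨Q, hQ⟩ := hLunr _ hzS
  have hσx : σ (loc x) = ε • loc x := conjActPlace_localization_of_eigen W τ (2 ^ M) hfix hε hx
  have hX : σ (loc x) = loc x ∨ σ (loc x) = -loc x := by
    rcases hε with rfl | rfl
    · left; rwa [one_zsmul] at hσx
    · right; rwa [neg_one_zsmul] at hσx
  have hnormloc : loc z + ε • σ (loc z) = unr (Q + ε • t Q) := by
    rw [← hQ, map_add, map_zsmul, hunr]
  have hαQ : addOrderOf (Q + ε • t Q) = 2 ^ α := by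
    rw [← addOrderOf_unr_eq (W.baseChange K) M w unr hunr0 (Q + ε • t Q), ← hnormloc]
    exact addOrderOf_eq_two_pow_of_forall_iff hα
  -- the basis value has the order of `loc x` modulo the Kummer condition
  have hPy : addOrderOf ((b.comp unr) Q₀ (loc x)) = 2 ^ β := by
    rw [AddMonoidHom.comp_apply]
    exact addOrderOf_invWeilPairing_unr_basis_eq (W.baseChange K) M e hμ hadd₁ hadd₂ hgal halt hnondeg w inv hinj t σ hσ hσb unr
      hunr hunrL hLunr Q₀ hspan hM0 hX hβ
  have hinv' : ∀ (u : (W.baseChange K).geomTorsion ((2 ^ M : ℕ) : ℤ))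
      (y : galoisCohomology (((W.baseChange K).torsionGaloisModule ((2 ^ M : ℕ) : ℤ)).toLocal (Sum.inr w)) 1),
      (b.comp unr) (t u) (σ y) = (b.comp unr) u y := fun u y ↦ by
    rw [AddMonoidHom.comp_apply, AddMonoidHom.comp_apply, hunr, hσb]
  rw [← hQ, show b (unr Q) (loc x) = (b.comp unr) Q (loc x) from rfl]
  rcases hε with rfl | rfl
  · rw [one_zsmul] at hαQ hσx
    exact normSharp_addOrderOf_pairing_of_fixed_of_basis t ht σ hσ (b.comp unr) hinv' Q₀ hspan hfree htor hσx hαQ hPy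
  · rw [neg_one_zsmul, ← sub_eq_add_neg] at hαQ
    rw [neg_one_zsmul] at hσx
    exact normSharp_addOrderOf_pairing_of_antifixed_of_basis t ht σ hσ (b.comp unr) hinv' Q₀ hspan hfree htor hσx hαQ hPy

include hK hΔ hM hℓ hk hF hw hτ1 hττ halt hnondeg hte hinj hinvc in
/-- **The norm-sharp law, flipped** (`loc x` on the left — the shape at the NEW prime of Kolyvagin's swap / of McCallum's certificate,
by the symmetry `invWeilPairing_comm`). [cite: McCallumLMS1991, §5 Lemma 5.3] [cite: Kolyvagin1991MathAnn, Thm. 2.1] -/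
theorem addOrderOf_invWeilPairing_localization_eq_of_norm_right
    {z x : galoisCohomology ((W.baseChange K).torsionGaloisModule ((2 ^ M : ℕ) : ℤ)) 1} {ε : ℤ} (hε : ε = 1 ∨ ε = -1)
    (hx : conjAct W τ ((2 ^ M : ℕ) : ℤ) x = ε • x)
    (hzS : galoisCohomology.localization ((W.baseChange K).torsionGaloisModule ((2 ^ M : ℕ) : ℤ)) (Sum.inr w : Place K) 1 z ∈
      (W.baseChange K).kummerSelmerStructure ((2 ^ M : ℕ) : ℤ) (Sum.inr w))
    {α β : ℕ}
    (hα : ∀ j : ℕ, (2 ^ j) • (galoisCohomology.localization ((W.baseChange K).torsionGaloisModule ((2 ^ M : ℕ) : ℤ))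
      (Sum.inr w : Place K) 1 z + ε • conjActPlace W τ ((2 ^ M : ℕ) : ℤ) hfix (galoisCohomology.localization
      ((W.baseChange K).torsionGaloisModule ((2 ^ M : ℕ) : ℤ)) (Sum.inr w : Place K) 1 z)) = 0 ↔ α ≤ j)
    (hβ : ∀ j : ℕ, (2 ^ j) • galoisCohomology.localization ((W.baseChange K).torsionGaloisModule ((2 ^ M : ℕ) : ℤ))
      (Sum.inr w : Place K) 1 x ∈ (W.baseChange K).kummerSelmerStructure ((2 ^ M : ℕ) : ℤ) (Sum.inr w) ↔ β ≤ j) :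
    addOrderOf (invWeilPairing (W.baseChange K) (2 ^ M) e hμ hadd₁ hadd₂ hgal inv (Sum.inr w)
        (galoisCohomology.localization ((W.baseChange K).torsionGaloisModule ((2 ^ M : ℕ) : ℤ)) (Sum.inr w : Place K) 1 x)
        (galoisCohomology.localization ((W.baseChange K).torsionGaloisModule ((2 ^ M : ℕ) : ℤ)) (Sum.inr w : Place K) 1 z)) =
      2 ^ (α + β - M) := by
  rw [invWeilPairing_comm (W.baseChange K) M e hμ hadd₁ hadd₂ hgal halt w inv]
  exact addOrderOf_invWeilPairing_localization_eq_of_norm W K hK hΔ hM hℓ hk hF w hw hτ1 hττ hfix e hμ hadd₁ hadd₂ hgal halt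
    hnondeg hte inv hinj hinvc hε hx hzS hα hβ

include hK hΔ hM hℓ hk hF hw hτ1 hττ halt hnondeg hte hinj hinvc in
/-- **Threshold form**: `2^j • inv_λ(loc z ∪ₑ loc x) = 0 ⟺ α + β ≤ M + j` — the certificate is NON-ZERO iff `α + β ≥ M + 1`, one bit
earlier than the eigen-frame guard `M + 2` whenever the norm class of `z` has full local order. [cite: McCallumLMS1991, §5 proof of Thm. 5.4] -/
theorem pow_smul_invWeilPairing_localization_eq_zero_iff_of_norm
    {z x : galoisCohomology ((W.baseChange K).torsionGaloisModule ((2 ^ M : ℕ) : ℤ)) 1} {ε : ℤ} (hε : ε = 1 ∨ ε = -1)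
    (hx : conjAct W τ ((2 ^ M : ℕ) : ℤ) x = ε • x)
    (hzS : galoisCohomology.localization ((W.baseChange K).torsionGaloisModule ((2 ^ M : ℕ) : ℤ)) (Sum.inr w : Place K) 1 z ∈
      (W.baseChange K).kummerSelmerStructure ((2 ^ M : ℕ) : ℤ) (Sum.inr w))
    {α β : ℕ}
    (hα : ∀ j : ℕ, (2 ^ j) • (galoisCohomology.localization ((W.baseChange K).torsionGaloisModule ((2 ^ M : ℕ) : ℤ))
      (Sum.inr w : Place K) 1 z + ε • conjActPlace W τ ((2 ^ M : ℕ) : ℤ) hfix (galoisCohomology.localization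
      ((W.baseChange K).torsionGaloisModule ((2 ^ M : ℕ) : ℤ)) (Sum.inr w : Place K) 1 z)) = 0 ↔ α ≤ j)
    (hβ : ∀ j : ℕ, (2 ^ j) • galoisCohomology.localization ((W.baseChange K).torsionGaloisModule ((2 ^ M : ℕ) : ℤ))
      (Sum.inr w : Place K) 1 x ∈ (W.baseChange K).kummerSelmerStructure ((2 ^ M : ℕ) : ℤ) (Sum.inr w) ↔ β ≤ j) (j : ℕ) :
    (2 ^ j) • invWeilPairing (W.baseChange K) (2 ^ M) e hμ hadd₁ hadd₂ hgal inv (Sum.inr w)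
        (galoisCohomology.localization ((W.baseChange K).torsionGaloisModule ((2 ^ M : ℕ) : ℤ)) (Sum.inr w : Place K) 1 z)
        (galoisCohomology.localization ((W.baseChange K).torsionGaloisModule ((2 ^ M : ℕ) : ℤ)) (Sum.inr w : Place K) 1 x) = 0 ↔
      α + β ≤ M + j := by
  rw [← addOrderOf_dvd_iff_nsmul_eq_zero,
    addOrderOf_invWeilPairing_localization_eq_of_norm W K hK hΔ hM hℓ hk hF w hw hτ1 hττ hfix e hμ hadd₁ hadd₂ hgal halt hnondeg hte
      inv hinj hinvc hε hx hzS hα hβ, Nat.pow_dvd_pow_iff_le_right one_lt_two]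
  omega

/-! ## §2 Sharp annihilation, assembled -/

include hK hΔ hM hℓ hk hF hw hτ1 hττ halt hnondeg hte hinj hinvc in
/-- **SHARP ANNIHILATION AT A DEEP INERT KOLYVAGIN PLACE.**  Same setting; `x` eigen of sign `ε` with «`2^j loc_λ x` Kummer `⟺ β ≤ j`»,
`z` ANY class with `loc_λ z` Kummer.  If `inv_λ(loc_λ z ∪ₑ loc_λ x) = 0` then **`2^(M − β) • (loc_λ z + ε σ_* loc_λ z) = 0`** (`= 2^(M−β) • loc_λ(z + ετ_* z)`).  This is
Kolyvagin's duality step (McCallum (13), Gross Prop. 8.2) for an ARBITRARY Selmer class `s = z` against a Kolyvagin class whose singular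
part at `λ` has exact order `2^β` modulo the Kummer condition: the NORM class `(1 + ετ_*)s` is killed locally by `2^(M−β)` — for an
eigenclass `s` this reads `2^(M−β+1) loc s = 0`, one bit weaker. [cite: McCallumLMS1991, §5 (13)] [cite: GrossLMS1991, §8 Prop. 8.2] -/
theorem two_pow_smul_localization_norm_eq_zero_of_invWeilPairing_eq_zero
    {z x : galoisCohomology ((W.baseChange K).torsionGaloisModule ((2 ^ M : ℕ) : ℤ)) 1} {ε : ℤ} (hε : ε = 1 ∨ ε = -1)
    (hx : conjAct W τ ((2 ^ M : ℕ) : ℤ) x = ε • x)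
    (hzS : galoisCohomology.localization ((W.baseChange K).torsionGaloisModule ((2 ^ M : ℕ) : ℤ)) (Sum.inr w : Place K) 1 z ∈
      (W.baseChange K).kummerSelmerStructure ((2 ^ M : ℕ) : ℤ) (Sum.inr w))
    {β : ℕ}
    (hβ : ∀ j : ℕ, (2 ^ j) • galoisCohomology.localization ((W.baseChange K).torsionGaloisModule ((2 ^ M : ℕ) : ℤ))
      (Sum.inr w : Place K) 1 x ∈ (W.baseChange K).kummerSelmerStructure ((2 ^ M : ℕ) : ℤ) (Sum.inr w) ↔ β ≤ j)
    (h0 : invWeilPairing (W.baseChange K) (2 ^ M) e hμ hadd₁ hadd₂ hgal inv (Sum.inr w)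
        (galoisCohomology.localization ((W.baseChange K).torsionGaloisModule ((2 ^ M : ℕ) : ℤ)) (Sum.inr w : Place K) 1 z)
        (galoisCohomology.localization ((W.baseChange K).torsionGaloisModule ((2 ^ M : ℕ) : ℤ)) (Sum.inr w : Place K) 1 x) = 0) :
    (2 ^ (M - β)) • (galoisCohomology.localization ((W.baseChange K).torsionGaloisModule ((2 ^ M : ℕ) : ℤ)) (Sum.inr w : Place K) 1 z
        + ε • conjActPlace W τ ((2 ^ M : ℕ) : ℤ) hfix
          (galoisCohomology.localization ((W.baseChange K).torsionGaloisModule ((2 ^ M : ℕ) : ℤ)) (Sum.inr w : Place K) 1 z)) = 0 := by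
  haveI : Fact (Nat.Prime 2) := ⟨Nat.prime_two⟩
  have hM0 : M ≠ 0 := by omega
  set loc := galoisCohomology.localization ((W.baseChange K).torsionGaloisModule ((2 ^ M : ℕ) : ℤ)) (Sum.inr w : Place K) 1
    with hloc
  set σ := conjActPlace W τ ((2 ^ M : ℕ) : ℤ) hfix with hσdef
  set t := (isLiftOfAut_liftAutPlace τ hfix).torsionMap W ((2 ^ M : ℕ) : ℤ) with htdef
  set b := invWeilPairing (W.baseChange K) (2 ^ M) e hμ hadd₁ hadd₂ hgal inv (Sum.inr w) with hb
  obtain ⟨hgood, hpw⟩ := hasGoodReductionAt_of_zhangKolyvaginPrime W K hℓ w hw 1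
  have hpw' : ((2 : ℕ) : 𝓞 K) ∉ w.asIdeal := by rwa [pow_one, Int.cast_natCast] at hpw
  have hσ : ∀ X, σ (σ X) = X := fun X ↦ conjActPlace_conjActPlace_self W τ (2 ^ M) hττ hfix X
  have hσb := invWeilPairing_conjActPlace_self W τ (2 ^ M) e hμ hadd₁ hadd₂ hgal hfix hte inv hinvc
  obtain ⟨unr, hunr0, hunrL, hLunr, hunr⟩ :=
    exists_unramified_parametrization_kummer W K hK hℓ hk w hw hpw' hgood τ hfix
  obtain ⟨Q₀, htor, hspan, hfree, ht⟩ := exists_regular_frame_liftAutPlace W K hK hΔ hM hℓ hk hF w hw hτ1 hfix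
  obtain ⟨Q, hQ⟩ := hLunr _ hzS
  have hσx : σ (loc x) = ε • loc x := conjActPlace_localization_of_eigen W τ (2 ^ M) hfix hε hx
  have hX : σ (loc x) = loc x ∨ σ (loc x) = -loc x := by
    rcases hε with rfl | rfl
    · left; rwa [one_zsmul] at hσx
    · right; rwa [neg_one_zsmul] at hσx
  have hnormloc : loc z + ε • σ (loc z) = unr (Q + ε • t Q) := by
    rw [← hQ, map_add, map_zsmul, hunr]
  have hPy : addOrderOf ((b.comp unr) Q₀ (loc x)) = 2 ^ β := by
    rw [AddMonoidHom.comp_apply]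
    exact addOrderOf_invWeilPairing_unr_basis_eq (W.baseChange K) M e hμ hadd₁ hadd₂ hgal halt hnondeg w inv hinj t σ hσ hσb unr
      hunr hunrL hLunr Q₀ hspan hM0 hX hβ
  have hinv' : ∀ (u : (W.baseChange K).geomTorsion ((2 ^ M : ℕ) : ℤ))
      (y : galoisCohomology (((W.baseChange K).torsionGaloisModule ((2 ^ M : ℕ) : ℤ)).toLocal (Sum.inr w)) 1),
      (b.comp unr) (t u) (σ y) = (b.comp unr) u y := fun u y ↦ by
    rw [AddMonoidHom.comp_apply, AddMonoidHom.comp_apply, hunr, hσb]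
  have h0' : (b.comp unr) Q (loc x) = 0 := by rw [AddMonoidHom.comp_apply, hQ]; exact h0
  rw [hnormloc, ← map_nsmul]
  rcases hε with rfl | rfl
  · rw [one_zsmul] at hσx ⊢
    rw [two_pow_smul_norm_eq_zero_of_pairing_eq_zero_of_basis t ht σ hσ (b.comp unr) hinv' Q₀ hspan hfree htor hσx hPy h0', map_zero]
  · rw [neg_one_zsmul] at hσx
    rw [neg_one_zsmul, ← sub_eq_add_neg,
      two_pow_smul_conorm_eq_zero_of_pairing_eq_zero_of_basis t ht σ hσ (b.comp unr) hinv' Q₀ hspan hfree htor hσx hPy h0', map_zero]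

/-! ## §3 The invisible bottom layer, assembled -/

include hK hΔ hM hℓ hk hF hw hτ1 hττ hte hinvc in
/-- **THE INVISIBLE BOTTOM LAYER AT A DEEP INERT KOLYVAGIN PLACE.**  Same setting.  If `loc_λ z` is Kummer, `2 • loc_λ z = 0` and `τ_* z = z`
(e.g. `z` a `2`-torsion class restricted from `ℚ`), then **`inv_λ(loc_λ z ∪ₑ loc_λ x) = 0` for EVERY `x` with `τ_* x = ±x`** — no order
or Kummer-threshold hypothesis on `x`.  Every local term of McCallum's Cassels–Tate sum (Prop. 4.7) for a Kolyvagin class against such a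
`z` vanishes: the `K`-frame certificates of Thm. 5.4 / 5.8 never see the bottom layer of `Ш(E/K)` that comes from `ℚ`.
[cite: McCallumLMS1991, §4 Prop. 4.7, §5 Lemma 5.3, Thm. 5.4] [cite: GrossLMS1991, Prop. 5.4, §8 Prop. 8.2] -/
theorem invWeilPairing_localization_eq_zero_of_two_smul_of_conjAct_eq
    {z x : galoisCohomology ((W.baseChange K).torsionGaloisModule ((2 ^ M : ℕ) : ℤ)) 1} {ε : ℤ} (hε : ε = 1 ∨ ε = -1)
    (hx : conjAct W τ ((2 ^ M : ℕ) : ℤ) x = ε • x) (hz : conjAct W τ ((2 ^ M : ℕ) : ℤ) z = z)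
    (hzS : galoisCohomology.localization ((W.baseChange K).torsionGaloisModule ((2 ^ M : ℕ) : ℤ)) (Sum.inr w : Place K) 1 z ∈
      (W.baseChange K).kummerSelmerStructure ((2 ^ M : ℕ) : ℤ) (Sum.inr w))
    (h2 : (2 : ℤ) • galoisCohomology.localization ((W.baseChange K).torsionGaloisModule ((2 ^ M : ℕ) : ℤ)) (Sum.inr w : Place K) 1 z
      = 0) :
    invWeilPairing (W.baseChange K) (2 ^ M) e hμ hadd₁ hadd₂ hgal inv (Sum.inr w)
        (galoisCohomology.localization ((W.baseChange K).torsionGaloisModule ((2 ^ M : ℕ) : ℤ)) (Sum.inr w : Place K) 1 z)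
        (galoisCohomology.localization ((W.baseChange K).torsionGaloisModule ((2 ^ M : ℕ) : ℤ)) (Sum.inr w : Place K) 1 x) = 0 := by
  haveI : Fact (Nat.Prime 2) := ⟨Nat.prime_two⟩
  set loc := galoisCohomology.localization ((W.baseChange K).torsionGaloisModule ((2 ^ M : ℕ) : ℤ)) (Sum.inr w : Place K) 1
    with hloc
  set σ := conjActPlace W τ ((2 ^ M : ℕ) : ℤ) hfix with hσdef
  set t := (isLiftOfAut_liftAutPlace τ hfix).torsionMap W ((2 ^ M : ℕ) : ℤ) with htdef
  set b := invWeilPairing (W.baseChange K) (2 ^ M) e hμ hadd₁ hadd₂ hgal inv (Sum.inr w) with hb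
  obtain ⟨hgood, hpw⟩ := hasGoodReductionAt_of_zhangKolyvaginPrime W K hℓ w hw 1
  have hpw' : ((2 : ℕ) : 𝓞 K) ∉ w.asIdeal := by rwa [pow_one, Int.cast_natCast] at hpw
  have hσ : ∀ X, σ (σ X) = X := fun X ↦ conjActPlace_conjActPlace_self W τ (2 ^ M) hττ hfix X
  have hσb := invWeilPairing_conjActPlace_self W τ (2 ^ M) e hμ hadd₁ hadd₂ hgal hfix hte inv hinvc
  obtain ⟨unr, hunr0, hunrL, hLunr, hunr⟩ :=
    exists_unramified_parametrization_kummer W K hK hℓ hk w hw hpw' hgood τ hfix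
  obtain ⟨Q₀, htor, hspan, hfree, ht⟩ := exists_regular_frame_liftAutPlace W K hK hΔ hM hℓ hk hF w hw hτ1 hfix
  obtain ⟨Q, hQ⟩ := hLunr _ hzS
  have hσx : σ (loc x) = ε • loc x := conjActPlace_localization_of_eigen W τ (2 ^ M) hfix hε hx
  have hX : σ (loc x) = loc x ∨ σ (loc x) = -loc x := by
    rcases hε with rfl | rfl
    · left; rwa [one_zsmul] at hσx
    · right; rwa [neg_one_zsmul] at hσx
  -- `Q` is `2`-torsion and `t`-fixed
  have h2Q : (2 : ℤ) • Q = 0 := by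
    apply hunr0
    rw [map_zsmul, hQ, map_zero]
    exact h2
  have htQ : t Q = Q := by
    apply hunr0
    rw [hunr, hQ, conjActPlace_localization_self W τ (2 ^ M) hfix z, hz]
  have hinv' : ∀ (u : (W.baseChange K).geomTorsion ((2 ^ M : ℕ) : ℤ))
      (y : galoisCohomology (((W.baseChange K).torsionGaloisModule ((2 ^ M : ℕ) : ℤ)).toLocal (Sum.inr w)) 1),
      (b.comp unr) (t u) (σ y) = (b.comp unr) u y := fun u y ↦ by
    rw [AddMonoidHom.comp_apply, AddMonoidHom.comp_apply, hunr, hσb]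
  rw [← hQ, show b (unr Q) (loc x) = (b.comp unr) Q (loc x) from rfl]
  exact pairing_eq_zero_of_two_smul_eq_zero_of_fixed t ht σ hσ (b.comp unr) hinv' Q₀ hspan hfree htor hM h2Q htQ hX

include hK hΔ hM hℓ hk hF hw hτ1 hττ halt hte hinvc in
/-- **The invisible bottom layer, flipped** (`loc x` on the left, by `invWeilPairing_comm`). [cite: McCallumLMS1991, §4 Prop. 4.7] -/
theorem invWeilPairing_localization_eq_zero_of_two_smul_of_conjAct_eq_right
    {z x : galoisCohomology ((W.baseChange K).torsionGaloisModule ((2 ^ M : ℕ) : ℤ)) 1} {ε : ℤ} (hε : ε = 1 ∨ ε = -1)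
    (hx : conjAct W τ ((2 ^ M : ℕ) : ℤ) x = ε • x) (hz : conjAct W τ ((2 ^ M : ℕ) : ℤ) z = z)
    (hzS : galoisCohomology.localization ((W.baseChange K).torsionGaloisModule ((2 ^ M : ℕ) : ℤ)) (Sum.inr w : Place K) 1 z ∈
      (W.baseChange K).kummerSelmerStructure ((2 ^ M : ℕ) : ℤ) (Sum.inr w))
    (h2 : (2 : ℤ) • galoisCohomology.localization ((W.baseChange K).torsionGaloisModule ((2 ^ M : ℕ) : ℤ)) (Sum.inr w : Place K) 1 z
      = 0) :
    invWeilPairing (W.baseChange K) (2 ^ M) e hμ hadd₁ hadd₂ hgal inv (Sum.inr w)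
        (galoisCohomology.localization ((W.baseChange K).torsionGaloisModule ((2 ^ M : ℕ) : ℤ)) (Sum.inr w : Place K) 1 x)
        (galoisCohomology.localization ((W.baseChange K).torsionGaloisModule ((2 ^ M : ℕ) : ℤ)) (Sum.inr w : Place K) 1 z) = 0 := by
  rw [invWeilPairing_comm (W.baseChange K) M e hμ hadd₁ hadd₂ hgal halt w inv]
  exact invWeilPairing_localization_eq_zero_of_two_smul_of_conjAct_eq W K hK hΔ hM hℓ hk hF w hw hτ1 hττ hfix e hμ hadd₁ hadd₂ hgal
    hte inv hinvc hε hx hz hzS h2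

end Frame

end Summit.BirchSwinnertonDyer.BirchSwinnertonDyer.Theorems.GenusExact.PlusDescent

end
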